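import Summits.AtomisticToContinuum.BoseEinsteinCondensation.Theorems.BECCutLineWeakDisorderWitnessTransferWitness
import Literature.MathematicalPhysics.QuantumManyBody.GroundStateFeynmanKacProofs
import Literature.MathematicalPhysics.QuantumManyBody.PeriodicFeynmanKacTrialState
import Mathlib
import HarnessLib

/-!
# Crux `LandscapeBound` (stmt-AtomisticToContinuum-9087), line `Sketch`: the transfer stub

Support file (does not close the item) for the crux `…Theses.BECCutLineWeakDisorder.LandscapeBound`,
line `Sketch`. The line bounds the landscape ratio `∫ L³ m₀²/s₀² ≤ C` of the Feynman–Kac GROUND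
STATE `Ψ₀ = fkGroundState v (n+1) L` (bounded `v`); `stub_witnessOfGroundState` TRANSFERS such a
bound, at fixed `(n, L)`, to NONNEGATIVE `C¹` `δ`-near-minimisers for every `δ > 0` (constant
`C + 1`): `Ψ₀` is a continuous `IsGroundStateFK` witness (`GroundStateFeynmanKac_holds`); the
symmetric `C¹` near-minimisers `c · trialFn L θ Ψ₀` (dilate towards the centre, mollify,
normalise; `c² ≤ 1 + ε`, energy `≤ E₀ + ε`, `θ → 1⁺` in any prescribed eventually-true set) are
those of `exists_trialState_energy_le`, RE-PROVED here privately, arithmetic split into lemmas,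
from the accepted support file `Theorems/BECCutLineWeakDisorderWitnessTransferTrial.lean`
(namespace `CutLineWitness`; no library build on the hub at the time of writing, so it cannot be
imported); `CutLineWitness.landscape_witness` (dominated convergence for the ratio along
`g θ = trialFn L θ Ψ₀`) concludes. References: Chung–Zhao, *From Brownian Motion to
Schrödinger's Equation* (1995), Thm 3.27, Prop 3.29 (81) [ChungZhao1995]; Lieb–Seiringer–
Solovej–Yngvason (2005), §1.2 (1.16)–(1.17) [LSSY2005].
-/

noncomputable section

open MeasureTheory Filter Set
open scoped ENNReal NNReal Topology

namespace Summit.AtomisticToContinuum.BoseEinsteinCondensation.Theorems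

open Literature.MathematicalPhysics.QuantumManyBody.BoseGas

namespace LandscapeBoundLine

/-! ### Near-minimisers (private re-proof of `CutLineWitness`, Trial file) -/

variable {N : ℕ}

/-- A function vanishing off the box has compact support. [folklore] -/
private theorem hasCompactSupport_of_eq_zero_box {ψ : Config N → ℝ} {L : ℝ}
    (h0 : ∀ X, X ∉ boxN N L → ψ X = 0) : HasCompactSupport ψ :=
  HasCompactSupport.intro (isCompact_closedBall (0 : Config N) (3 * |L|))
    fun X hX => h0 X fun hb => hX (boxN_subset_closedBall N L hb)

/-- The square of the trial function is integrable (`L > 0`, `θ > 1`). [folklore] -/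
private theorem integrable_trialFn_sq {L θ : ℝ} {Ψ₀ : Config N → ℝ} (hL : 0 < L) (hθ : 1 < θ)
    (hcont : Continuous Ψ₀) (h0 : ∀ X, X ∉ boxN N L → Ψ₀ X = 0) :
    Integrable (fun X => trialFn L θ Ψ₀ X ^ 2) volume :=
  ((contDiff_trialFn hcont).continuous.memLp_of_hasCompactSupport
    (hasCompactSupport_of_eq_zero_box (trialFn_eq_zero hL hθ h0))).integrable_sq

/-- `𝓔[c φ] = c² (∫|∇φ|² + ∫ φ² V)` for a real `C¹` `φ`. [cite: LSSY2005, §1.2 (1.16)] -/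
private theorem energy_of_ofReal_mul {L : ℝ} (Ψ : TrialState N L) {c : ℝ} {φ : Config N → ℝ}
    (hφC : ContDiff ℝ 1 φ) (hΨ : Ψ.ψ = fun X => (((c * φ X : ℝ)) : ℂ)) (v : ℝ → ℝ≥0∞) :
    energy v Ψ = ENNReal.ofReal (c ^ 2) *
      ((∫⁻ X, realKinetic φ X) + ∫⁻ X, ENNReal.ofReal (φ X ^ 2) * interaction v X) := by
  have hφd : Differentiable ℝ φ := hφC.differentiable one_ne_zero
  have hcφd : Differentiable ℝ fun Y => c * φ Y := (differentiable_const c).mul hφd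
  have hkin : ∀ X, kineticDensity Ψ.ψ X = ENNReal.ofReal (c ^ 2) * realKinetic φ X := by
    intro X
    rw [hΨ, kineticDensity_ofReal hcφd, realKinetic_const_mul_periodic hφd]
  have hnorm : ∀ X, (‖Ψ.ψ X‖₊ : ℝ≥0∞) ^ 2 = ENNReal.ofReal (c ^ 2) * ENNReal.ofReal (φ X ^ 2) := by
    intro X
    rw [hΨ, ennnorm_sq_ofReal_periodic, mul_pow, ENNReal.ofReal_mul (sq_nonneg _)]
  unfold energy
  simp_rw [hkin, hnorm]
  have h1 : ∀ X, ENNReal.ofReal (c ^ 2) * realKinetic φ X +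
      interaction v X * (ENNReal.ofReal (c ^ 2) * ENNReal.ofReal (φ X ^ 2)) =
      ENNReal.ofReal (c ^ 2) * (realKinetic φ X + ENNReal.ofReal (φ X ^ 2) * interaction v X) := by
    intro X; ring
  simp_rw [h1]
  rw [lintegral_const_mul' _ _ ENNReal.ofReal_ne_top,
    lintegral_add_left (measurable_realKinetic hφC)]

/-- `|∫ (φ² - Ψ₀²) w| ≤ B · vol(Λ) · 2M · s` when `sup|φ - Ψ₀| ≤ s`, `|φ|, |Ψ₀| ≤ M`, `|w| ≤ B`,
and both functions vanish off the box. [folklore] -/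
private theorem abs_integral_sq_sub_sq_mul_le {L : ℝ} {φ Ψ₀ w : Config N → ℝ}
    {M s B : ℝ} (hM0 : 0 ≤ M) (hs0 : 0 ≤ s) (hφM : ∀ X, |φ X| ≤ M) (hΨM : ∀ X, |Ψ₀ X| ≤ M)
    (hw : ∀ X, |w X| ≤ B) (hφ0 : ∀ X, X ∉ boxN N L → φ X = 0)
    (hΨ0 : ∀ X, X ∉ boxN N L → Ψ₀ X = 0) (hsup : ∀ X, |φ X - Ψ₀ X| ≤ s) :
    |∫ X, (φ X ^ 2 - Ψ₀ X ^ 2) * w X| ≤ B * (volume (boxN N L)).toReal * (2 * M) * s := by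
  have hpt : ∀ X, |(φ X ^ 2 - Ψ₀ X ^ 2) * w X| ≤
      (boxN N L).indicator (fun _ => B * (2 * M) * s) X := by
    intro X
    by_cases hX : X ∈ boxN N L
    · rw [Set.indicator_of_mem hX, abs_mul,
        show φ X ^ 2 - Ψ₀ X ^ 2 = (φ X - Ψ₀ X) * (φ X + Ψ₀ X) by ring, abs_mul]
      calc |φ X - Ψ₀ X| * |φ X + Ψ₀ X| * |w X| ≤ s * (M + M) * B := by
            refine mul_le_mul (mul_le_mul (hsup X)
              ((abs_add_le _ _).trans (add_le_add (hφM X) (hΨM X))) (abs_nonneg _) hs0) (hw X)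
              (abs_nonneg _) (by positivity)
        _ = B * (2 * M) * s := by ring
    · rw [Set.indicator_of_notMem hX, hφ0 X hX, hΨ0 X hX]; simp
  have hint : Integrable ((boxN N L).indicator fun _ : Config N => B * (2 * M) * s) volume := by
    refine IntegrableOn.integrable_indicator ?_ (measurableSet_boxN N L)
    exact integrableOn_const (volume_boxN_lt_top N L).ne
  calc |∫ X, (φ X ^ 2 - Ψ₀ X ^ 2) * w X|
      ≤ ∫ X, (boxN N L).indicator (fun _ => B * (2 * M) * s) X := by
        rw [← Real.norm_eq_abs]
        refine norm_integral_le_of_norm_le hint (Eventually.of_forall fun X => ?_)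
        rw [Real.norm_eq_abs]; exact hpt X
    _ = B * (volume (boxN N L)).toReal * (2 * M) * s := by
        rw [integral_indicator_const _ (measurableSet_boxN N L), smul_eq_mul, measureReal_def]
        ring

/-- The potential integral of a bounded potential against `Ψ₀²`, real form. [folklore] -/
private theorem lintegral_sq_mul_interaction_eq_ofReal {v : ℝ → ℝ≥0∞} (hv : Measurable v)
    {C : ℝ≥0} (hC : ∀ r, v r ≤ C) {Ψ₀ : Config N → ℝ} (hΨm : Measurable Ψ₀)
    (hsq : Integrable (fun X => Ψ₀ X ^ 2) volume) :
    ∫⁻ X, ENNReal.ofReal (Ψ₀ X ^ 2) * interaction v X =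
      ENNReal.ofReal (∫ X, Ψ₀ X ^ 2 * (interaction v X).toReal) := by
  set CV : ℝ≥0 := (N * N : ℕ) * C with hCVdef
  have hVle : ∀ X : Config N, interaction v X ≤ CV := fun X => by
    have := interaction_le_of_le (C := (C : ℝ≥0∞)) (fun r => hC r) X
    simpa [hCVdef] using this
  have hVtop : ∀ X : Config N, interaction v X ≠ ⊤ :=
    fun X => ne_top_of_le_ne_top ENNReal.coe_ne_top (hVle X)
  have hVm : Measurable (interaction (N := N) v) := measurable_interaction hv
  have hint : Integrable (fun X => Ψ₀ X ^ 2 * (interaction v X).toReal) volume := by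
    refine (hsq.mul_const (CV : ℝ)).mono'
      ((hΨm.pow_const 2).mul hVm.ennreal_toReal).aestronglyMeasurable
      (Eventually.of_forall fun X => ?_)
    rw [Real.norm_eq_abs, abs_mul, abs_of_nonneg (sq_nonneg _), abs_of_nonneg ENNReal.toReal_nonneg]
    refine mul_le_mul_of_nonneg_left ?_ (sq_nonneg _)
    have := ENNReal.toReal_mono ENNReal.coe_ne_top (hVle X)
    simpa using this
  rw [ofReal_integral_eq_lintegral_ofReal hint (Eventually.of_forall fun X =>
    mul_nonneg (sq_nonneg _) ENNReal.toReal_nonneg)]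
  refine lintegral_congr fun X => ?_
  rw [ENNReal.ofReal_mul (sq_nonneg _), ENNReal.ofReal_toReal (hVtop X)]

/-- The potential energy of an eigenfunction candidate is at most `λ`: `∫ Ψ₀² V ≤ λ`. [folklore] -/
private theorem integral_sq_mul_interaction_le {v : ℝ → ℝ≥0∞} (hv : Measurable v) {C : ℝ≥0}
    (hC : ∀ r, v r ≤ C) {L : ℝ} {Ψ₀ : Config N → ℝ} (hcont : Continuous Ψ₀)
    (h0 : ∀ X, X ∉ boxN N L → Ψ₀ X = 0) (hnn : ∀ X, 0 ≤ Ψ₀ X) (hnorm : ∫ X, Ψ₀ X ^ 2 = 1)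
    {lam : ℝ} (heig : ∀ t : ℝ, 0 < t → Real.exp (-(lam * t)) ≤ ∫ X, Ψ₀ X * fkReal v L t Ψ₀ X) :
    ∫ X, Ψ₀ X ^ 2 * (interaction v X).toReal ≤ lam := by
  by_contra! hlt
  set K : ℝ := lam - ∫ X, Ψ₀ X ^ 2 * (interaction v X).toReal with hK
  have hK0 : K < 0 := by rw [hK]; linarith
  have hev := sqIncr_toReal_eventually_le hv hC hcont h0 hnn hnorm heig (K' := K / 2) (by linarith)
  obtain ⟨t, ht, htpos⟩ := (hev.and self_mem_nhdsWithin).exists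
  have ht' : (0 : ℝ) < t := by exact_mod_cast htpos
  have h0le : 0 ≤ (sqIncr t Ψ₀).toReal := ENNReal.toReal_nonneg
  nlinarith

/-- If `0 < n`, `1 - τ ≤ n`, `τ ≤ 1/4` and `4τ ≤ ε`, then `n⁻¹ ≤ 1 + ε`. [folklore] -/
private theorem inv_le_one_add_of_sub_le {n τ ε : ℝ} (hε : 0 < ε) (hτ1 : τ ≤ 1 / 4)
    (hτε : 4 * τ ≤ ε) (hn : 1 - τ ≤ n) (hn0 : 0 < n) : n⁻¹ ≤ 1 + ε := by
  have hA : τ * ε ≤ 1 / 4 * ε := mul_le_mul_of_nonneg_right hτ1 hε.le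
  have hkey : 1 ≤ (1 - τ) * (1 + ε) := by nlinarith
  have h1ε : (0 : ℝ) < 1 + ε := by linarith
  have hτpos : 0 < 1 - τ := by linarith
  have h1 : (1 + ε)⁻¹ ≤ 1 - τ := (inv_le_iff_one_le_mul₀ h1ε).2 hkey
  calc n⁻¹ ≤ (1 - τ)⁻¹ := (inv_le_inv₀ hn0 hτpos).2 hn
    _ ≤ ((1 + ε)⁻¹)⁻¹ := (inv_le_inv₀ hτpos (inv_pos.2 h1ε)).2 h1
    _ = 1 + ε := inv_inv _

/-- Scale arithmetic: `B·vol·2M·τ/((C_V+1)(vol+1)(2M+1)) ≤ τ` when `B ≤ C_V + 1`. [folklore] -/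
private theorem mul_mul_mul_div_le {B CV vol M τ : ℝ} (hB1 : B ≤ CV + 1) (hCV0 : 0 ≤ CV)
    (hvol0 : 0 ≤ vol) (hM : 0 ≤ M) (hτ : 0 ≤ τ) :
    B * vol * (2 * M) * (τ / ((CV + 1) * (vol + 1) * (2 * M + 1))) ≤ τ := by
  have h : B * vol * (2 * M) ≤ (CV + 1) * (vol + 1) * (2 * M + 1) :=
    calc B * vol * (2 * M) ≤ (CV + 1) * vol * (2 * M) := by gcongr
      _ ≤ (CV + 1) * (vol + 1) * (2 * M + 1) := by gcongr <;> linarith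
  rw [← mul_div_assoc, div_le_iff₀ (by positivity)]
  nlinarith [mul_le_mul_of_nonneg_left h hτ]

/-- Energy arithmetic: `n⁻¹ (K' + η + PotV) ≤ λ + ε` (`τ = η / (λ + 4η + 1)`). [folklore] -/
private theorem inv_mul_energy_le {n τ η lam Pot PotV K' ε : ℝ} (hn0 : 0 < n)
    (hn_low : 1 - τ ≤ n) (hPVle : PotV ≤ Pot + τ) (hK' : K' = lam - Pot + η) (hτη : τ ≤ η)
    (hτ : τ = η / (lam + 4 * η + 1)) (hη : 0 < η) (hlam0 : 0 ≤ lam) (hη4 : 4 * η ≤ ε) :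
    n⁻¹ * (K' + η + PotV) ≤ lam + ε := by
  have hτlam : τ * (lam + 4 * η) ≤ η := by
    rw [hτ, div_mul_eq_mul_div, div_le_iff₀ (by linarith)]; nlinarith
  rw [inv_mul_le_iff₀ hn0, hK']
  have h2 : lam + 3 * η ≤ n * (lam + 4 * η) := by
    nlinarith [mul_le_mul_of_nonneg_right hn_low (by linarith : (0 : ℝ) ≤ lam + 4 * η)]
  nlinarith [mul_le_mul_of_nonneg_left hη4 hn0.le]

/-- **Symmetric `C¹` Dirichlet near-minimisers next to a ground-state candidate**: for every
`ε > 0` and every property `P` holding eventually as `θ → 1⁺` there are `θ > 1` with `P θ`,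
`0 < c`, `c² ≤ 1 + ε` and `Ψ ∈ TrialState N L` with `Ψ.ψ = c · trialFn L θ Ψ₀`,
`energy v Ψ ≤ λ + ε`. [cite: ChungZhao1995, Thm 3.27 and Prop 3.29 (81)] -/
private theorem exists_trialState_energy_le {L : ℝ} (hL : 0 < L) {v : ℝ → ℝ≥0∞}
    (hv : Measurable v) {C : ℝ≥0} (hC : ∀ r, v r ≤ C) {Ψ₀ : Config N → ℝ}
    (hcont : Continuous Ψ₀) (h0 : ∀ X, X ∉ boxN N L → Ψ₀ X = 0) (hnn : ∀ X, 0 ≤ Ψ₀ X)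
    (hsymm : ∀ (σ : Equiv.Perm (Fin N)) (X : Config N), Ψ₀ (X ∘ σ) = Ψ₀ X)
    (hnorm : ∫ X, Ψ₀ X ^ 2 = 1) {lam : ℝ}
    (heig : ∀ t : ℝ, 0 < t → Real.exp (-(lam * t)) ≤ ∫ X, Ψ₀ X * fkReal v L t Ψ₀ X)
    {P : ℝ → Prop} (hP : ∀ᶠ θ in 𝓝[>] (1 : ℝ), P θ) {ε : ℝ≥0} (hε : 0 < ε) :
    ∃ (θ : ℝ) (c : ℝ) (Ψ : TrialState N L), 1 < θ ∧ P θ ∧ 0 < c ∧ c ^ 2 ≤ 1 + ε ∧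
      (Ψ.ψ = fun X => (((c * trialFn L θ Ψ₀ X : ℝ)) : ℂ)) ∧
      energy v Ψ ≤ ENNReal.ofReal lam + ε := by
  have hcs := hasCompactSupport_of_eq_zero_box h0
  have hΨm : Measurable Ψ₀ := hcont.measurable
  obtain ⟨M0, hM0⟩ := hcs.exists_bound_of_continuous hcont
  set M : ℝ := max M0 0 with hMdef
  have hMnn : 0 ≤ M := le_max_right _ _
  have hMabs : ∀ X, |Ψ₀ X| ≤ M := fun X => by
    have := hM0 X; rw [Real.norm_eq_abs] at this; exact this.trans (le_max_left _ _)
  have hΨsq : Integrable (fun X => Ψ₀ X ^ 2) volume :=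
    (hcont.memLp_of_hasCompactSupport hcs).integrable_sq
  set Pot : ℝ := ∫ X, Ψ₀ X ^ 2 * (interaction v X).toReal with hPotdef
  have hPot0 : 0 ≤ Pot := integral_nonneg fun X => mul_nonneg (sq_nonneg _) ENNReal.toReal_nonneg
  have hPotle : Pot ≤ lam := integral_sq_mul_interaction_le hv hC hcont h0 hnn hnorm heig
  have hlam0 : 0 ≤ lam := hPot0.trans hPotle
  set CV : ℝ := ((N * N : ℕ) : ℝ) * C with hCVdef
  have hCV0 : 0 ≤ CV := by positivity
  have hVreal : ∀ X : Config N, |(interaction v X).toReal| ≤ CV := fun X => by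
    rw [abs_of_nonneg ENNReal.toReal_nonneg]
    have h1 := interaction_le_of_le (C := (C : ℝ≥0∞)) (fun r => hC r) X
    have h2 : ((N * N : ℕ) : ℝ≥0∞) * (C : ℝ≥0∞) ≠ ⊤ :=
      ENNReal.mul_ne_top (ENNReal.natCast_ne_top _) ENNReal.coe_ne_top
    have := ENNReal.toReal_mono h2 h1
    rw [ENNReal.toReal_mul] at this
    simpa [hCVdef] using this
  set vol : ℝ := (volume (boxN N L)).toReal with hvoldef
  have hvol0 : 0 ≤ vol := ENNReal.toReal_nonneg
  set η : ℝ := min ((ε : ℝ) / 4) (1 / 4) with hηdef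
  have hε' : (0 : ℝ) < ε := by exact_mod_cast hε
  have hη : 0 < η := lt_min (by linarith) (by norm_num)
  have hη4 : 4 * η ≤ ε := by have := min_le_left ((ε : ℝ) / 4) (1 / 4); linarith
  have hη1 : η ≤ 1 / 4 := min_le_right _ _
  set K' : ℝ := lam - Pot + η with hK'def
  have hK' : lam - Pot < K' := by rw [hK'def]; linarith
  have hK'0 : 0 ≤ K' := by rw [hK'def]; linarith
  have hev := sqIncr_div_eventually_le hv hC hcont h0 hnn hnorm heig hK'
  set τ : ℝ := η / (lam + 4 * η + 1) with hτdef
  have hτ : 0 < τ := div_pos hη (by linarith)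
  have hτη : τ ≤ η := by rw [hτdef]; exact div_le_self hη.le (by linarith)
  set s : ℝ := τ / ((CV + 1) * (vol + 1) * (2 * M + 1)) with hsdef
  have hs : 0 < s := div_pos hτ (by positivity)
  have hunif := trialFn_tendsto_uniformly hL hcont h0 hs
  have hsq : ∀ᶠ θ : ℝ in 𝓝[>] 1, θ ^ 2 * K' ≤ K' + η := by
    have hc : Continuous fun θ : ℝ => θ ^ 2 * K' := by fun_prop
    have h1 : (fun θ : ℝ => θ ^ 2 * K') 1 < K' + η := by simp [hη]
    exact ((hc.tendsto 1).eventually (gt_mem_nhds h1)).filter_mono nhdsWithin_le_nhds |>.mono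
      fun θ hθ => hθ.le
  obtain ⟨θ, ⟨⟨hu, hθsq⟩, hPθ⟩, hθ1⟩ := (((hunif.and hsq).and hP).and self_mem_nhdsWithin).exists
  have hθ1' : (1 : ℝ) < θ := hθ1
  set φ := trialFn L θ Ψ₀ with hφdef
  have hφC : ContDiff ℝ 1 φ := contDiff_trialFn hcont
  have hφm : Measurable φ := hφC.continuous.measurable
  have hφM : ∀ X, |φ X| ≤ M := abs_trialFn_le hMabs
  have hφ0 : ∀ X, X ∉ boxN N L → φ X = 0 := trialFn_eq_zero hL hθ1' h0
  have hφsq : Integrable (fun X => φ X ^ 2) volume := integrable_trialFn_sq hL hθ1' hcont h0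
  have hn1 : |(∫ X, φ X ^ 2) - 1| ≤ τ := by
    have heq : (∫ X, φ X ^ 2) - 1 = ∫ X, (φ X ^ 2 - Ψ₀ X ^ 2) * (fun _ => (1 : ℝ)) X := by
      simp only [mul_one]
      rw [integral_sub hφsq hΨsq, hnorm]
    rw [heq]
    refine (abs_integral_sq_sub_sq_mul_le (B := 1) hMnn hs.le hφM hMabs (fun _ => by norm_num)
      hφ0 h0 hu).trans ?_
    rw [hsdef]; exact mul_mul_mul_div_le (by linarith) hCV0 hvol0 hMnn hτ.le
  set PotV : ℝ := ∫ X, φ X ^ 2 * (interaction v X).toReal with hPotVdef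
  have hPV : |PotV - Pot| ≤ τ := by
    have hint1 : Integrable (fun X => φ X ^ 2 * (interaction v X).toReal) volume := by
      refine (hφsq.mul_const CV).mono' ((hφm.pow_const 2).mul
        (measurable_interaction hv).ennreal_toReal).aestronglyMeasurable
        (Eventually.of_forall fun X => ?_)
      rw [Real.norm_eq_abs, abs_mul, abs_of_nonneg (sq_nonneg _)]
      exact mul_le_mul_of_nonneg_left (hVreal X) (sq_nonneg _)
    have hint2 : Integrable (fun X => Ψ₀ X ^ 2 * (interaction v X).toReal) volume := by
      refine (hΨsq.mul_const CV).mono' ((hΨm.pow_const 2).mul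
        (measurable_interaction hv).ennreal_toReal).aestronglyMeasurable
        (Eventually.of_forall fun X => ?_)
      rw [Real.norm_eq_abs, abs_mul, abs_of_nonneg (sq_nonneg _)]
      exact mul_le_mul_of_nonneg_left (hVreal X) (sq_nonneg _)
    have heq : PotV - Pot = ∫ X, (φ X ^ 2 - Ψ₀ X ^ 2) * (interaction v X).toReal := by
      rw [hPotVdef, hPotdef, ← integral_sub hint1 hint2]
      refine integral_congr_ae (Eventually.of_forall fun X => ?_)
      ring
    rw [heq]
    refine (abs_integral_sq_sub_sq_mul_le hMnn hs.le hφM hMabs hVreal hφ0 h0 hu).trans ?_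
    rw [hsdef]; exact mul_mul_mul_div_le (by linarith) hCV0 hvol0 hMnn hτ.le
  have hn0 : 0 < ∫ X, φ X ^ 2 := by have := (abs_le.1 hn1).1; linarith
  set c : ℝ := (Real.sqrt (∫ X, φ X ^ 2))⁻¹ with hc
  have hcpos : 0 < c := by rw [hc]; exact inv_pos.2 (Real.sqrt_pos.2 hn0)
  have hc2 : c ^ 2 = (∫ X, φ X ^ 2)⁻¹ := by rw [hc, inv_pow, Real.sq_sqrt hn0.le]
  have hnormΨ : ∫⁻ X, ((‖((c * φ X : ℝ) : ℂ)‖₊ : ℝ≥0∞)) ^ 2 = 1 := by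
    have h1 : ∀ X, ((‖((c * φ X : ℝ) : ℂ)‖₊ : ℝ≥0∞)) ^ 2 =
        ENNReal.ofReal (c ^ 2) * ENNReal.ofReal (φ X ^ 2) := fun X => by
      rw [ennnorm_sq_ofReal_periodic, mul_pow, ENNReal.ofReal_mul (sq_nonneg _)]
    simp_rw [h1]
    rw [lintegral_const_mul' _ _ ENNReal.ofReal_ne_top,
      ← ofReal_integral_eq_lintegral_ofReal hφsq (Eventually.of_forall fun X => sq_nonneg _),
      ← ENNReal.ofReal_mul (sq_nonneg _), hc2, inv_mul_cancel₀ hn0.ne', ENNReal.ofReal_one]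
  let Ψ : TrialState N L :=
    { ψ := fun X => (((c * φ X : ℝ)) : ℂ)
      contDiff := Complex.ofRealCLM.contDiff.comp (contDiff_const.mul hφC)
      eq_zero := fun X hX => by simp [hφ0 X hX]
      symm := fun σ X => by
        show (((c * φ (X ∘ σ) : ℝ)) : ℂ) = (((c * φ X : ℝ)) : ℂ)
        rw [hφdef, trialFn_comp_perm hsymm σ X]
      norm_eq := hnormΨ }
  have hkin : ∫⁻ X, realKinetic φ X ≤ ENNReal.ofReal (K' + η) :=
    (lintegral_realKinetic_trialFn_le hθ1' hcont hMabs hev).trans (ENNReal.ofReal_le_ofReal hθsq)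
  have hpotE : ∫⁻ X, ENNReal.ofReal (φ X ^ 2) * interaction v X = ENNReal.ofReal PotV :=
    lintegral_sq_mul_interaction_eq_ofReal hv hC hφm hφsq
  have hPotV0 : 0 ≤ PotV := integral_nonneg fun X => mul_nonneg (sq_nonneg _) ENNReal.toReal_nonneg
  have hE : energy v Ψ ≤ ENNReal.ofReal ((∫ X, φ X ^ 2)⁻¹ * (K' + η + PotV)) := by
    rw [energy_of_ofReal_mul Ψ hφC rfl v, hpotE, hc2,
      ENNReal.ofReal_mul (inv_nonneg.2 hn0.le), ENNReal.ofReal_add (by linarith) hPotV0]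
    gcongr
  have hn_low : 1 - τ ≤ ∫ X, φ X ^ 2 := by have := (abs_le.1 hn1).1; linarith
  have hPVle : PotV ≤ Pot + τ := by have := (abs_le.1 hPV).2; linarith
  have hc2le : c ^ 2 ≤ 1 + ε := by
    rw [hc2]
    exact inv_le_one_add_of_sub_le hε' (hτη.trans hη1) (by linarith only [hτη, hη4]) hn_low hn0
  refine ⟨θ, c, Ψ, hθ1', hPθ, hcpos, hc2le, rfl, ?_⟩
  calc energy v Ψ ≤ ENNReal.ofReal ((∫ X, φ X ^ 2)⁻¹ * (K' + η + PotV)) := hE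
    _ ≤ ENNReal.ofReal (lam + ε) := ENNReal.ofReal_le_ofReal
        (inv_mul_energy_le hn0 hn_low hPVle hK'def hτη hτdef hη hlam0 hη4)
    _ ≤ ENNReal.ofReal lam + ENNReal.ofReal ε := ENNReal.ofReal_add_le
    _ = ENNReal.ofReal lam + ε := by rw [ENNReal.ofReal_coe_nnreal]

/-- **Transfer: from a ground-state landscape bound to near-minimising witnesses.** For a bounded
admissible `v`, `L > 0`, `0 ≤ C`: if `Ψ₀ = fkGroundState v (n+1) L` has landscape ratio
`∫ L³ m₀²/s₀² ≤ C`, then for every `δ > 0` there is a NONNEGATIVE `Ψ ∈ TrialState (n+1) L` with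
`energy v Ψ ≤ E₀ + δ` and landscape ratio `≤ C + 1` (`exists_trialState_energy_le` +
`CutLineWitness.landscape_witness`, with `GroundStateFeynmanKac_holds`). [folklore] -/
theorem stub_witnessOfGroundState :
    ∀ v : ℝ → ℝ≥0∞, IsRepulsiveFiniteRange v → (∃ K : ℝ≥0, ∀ r, v r ≤ K) →
      ∀ (n : ℕ) (L : ℝ), 0 < L → ∀ C : ℝ, 0 ≤ C →
        ∫⁻ Y : Config n, ENNReal.ofReal (L ^ 3) *
            (∫⁻ x, (‖fkGroundState v (n + 1) L (Matrix.vecCons x Y)‖₊ : ℝ≥0∞) ^ 2) ^ 2 /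
              (∫⁻ x, (‖fkGroundState v (n + 1) L (Matrix.vecCons x Y)‖₊ : ℝ≥0∞)) ^ 2 ≤
          ENNReal.ofReal C →
        ∀ δ : ℝ≥0∞, 0 < δ → ∃ Ψ : TrialState (n + 1) L,
          energy v Ψ ≤ groundStateEnergy v (n + 1) L + δ ∧ (∀ X, Ψ.ψ X = (‖Ψ.ψ X‖ : ℂ)) ∧
            ∫⁻ Y : Config n, ENNReal.ofReal (L ^ 3) *
                (∫⁻ x, (‖Ψ.ψ (Matrix.vecCons x Y)‖₊ : ℝ≥0∞) ^ 2) ^ 2 /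
                  (∫⁻ x, (‖Ψ.ψ (Matrix.vecCons x Y)‖₊ : ℝ≥0∞)) ^ 2 ≤ ENNReal.ofReal (C + 1) := by
  intro v hv hb n L hL C hC0 hC δ hδ
  obtain ⟨hGS, hcont, -⟩ := GroundStateFeynmanKac.fkGroundState GroundStateFeynmanKac_holds
    (N := n + 1) (by omega) hL hv.1 hb
  obtain ⟨K, hK⟩ := hb
  set Ψ₀ : Config (n + 1) → ℝ := fkGroundState v (n + 1) L with hΨ₀def
  set E₀ : ℝ≥0∞ := groundStateEnergy v (n + 1) L with hE₀def
  have h0 : ∀ X, X ∉ boxN (n + 1) L → Ψ₀ X = 0 := hGS.eq_zero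
  have hnn : ∀ X, 0 ≤ Ψ₀ X := hGS.nonneg
  have hcs := hasCompactSupport_of_eq_zero_box h0
  have hΨsq : Integrable (fun X => Ψ₀ X ^ 2) volume :=
    (hcont.memLp_of_hasCompactSupport hcs).integrable_sq
  have hnorm : ∫ X, Ψ₀ X ^ 2 = 1 := by
    have h1 : ENNReal.ofReal (∫ X, Ψ₀ X ^ 2) = 1 := by
      rw [ofReal_integral_eq_lintegral_ofReal hΨsq (Eventually.of_forall fun X => sq_nonneg _),
        ← hGS.norm_eq]
      exact lintegral_congr fun X => ENNReal.ofReal_pow (hnn X) 2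
    have h2 := congrArg ENNReal.toReal h1
    rwa [ENNReal.toReal_ofReal (integral_nonneg fun X => sq_nonneg _), ENNReal.toReal_one] at h2
  have heig : ∀ t : ℝ, 0 < t → Real.exp (-(E₀.toReal * t)) ≤ ∫ X, Ψ₀ X * fkReal v L t Ψ₀ X := by
    intro t ht
    have heq : (fun X => Ψ₀ X * fkReal v L t Ψ₀ X) =
        fun X => Real.exp (-(E₀.toReal * t)) * Ψ₀ X ^ 2 := by
      funext X
      rw [fkReal_eq_toReal_fkSemigroup hv.1 L t hGS.measurable hnn X, hGS.eigen t ht.le X,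
        ENNReal.toReal_ofReal (mul_nonneg (Real.exp_pos _).le (hnn X))]
      ring
    rw [heq, integral_const_mul, hnorm, mul_one]
  have hE : ENNReal.ofReal E₀.toReal = E₀ := ENNReal.ofReal_toReal hGS.energy_ne_top
  obtain ⟨M0, hM0⟩ := hcs.exists_bound_of_continuous hcont
  set M : ℝ := max M0 0 with hMdef
  have hMabs : ∀ X, |Ψ₀ X| ≤ M := fun X => by
    have := hM0 X; rw [Real.norm_eq_abs] at this; exact this.trans (le_max_left _ _)
  set g : ℝ → Config (n + 1) → ℝ := fun θ => if 1 < θ then trialFn L θ Ψ₀ else 0 with hgdef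
  have hg_of : ∀ θ : ℝ, 1 < θ → g θ = trialFn L θ Ψ₀ := fun θ hθ => if_pos hθ
  have hg : ∀ θ, Measurable (g θ) ∧ (∀ X, |g θ X| ≤ M) ∧
      (∀ X, X ∉ boxN (n + 1) L → g θ X = 0) ∧ ∀ X, 0 ≤ g θ X := fun θ => by
    by_cases hθ : 1 < θ
    · rw [hg_of θ hθ]
      exact ⟨(contDiff_trialFn hcont).continuous.measurable, abs_trialFn_le hMabs,
        trialFn_eq_zero hL hθ h0, trialFn_nonneg hnn⟩
    · rw [show g θ = 0 from if_neg hθ]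
      exact ⟨measurable_zero, fun X => by rw [Pi.zero_apply, abs_zero]; exact le_max_right _ _,
        fun X _ => rfl, fun X => le_rfl⟩
  have hunif : ∀ η : ℝ, 0 < η → ∀ᶠ θ in 𝓝[>] (1 : ℝ), ∀ X, |g θ X - Ψ₀ X| ≤ η := by
    intro η hη
    filter_upwards [trialFn_tendsto_uniformly hL hcont h0 hη, self_mem_nhdsWithin] with θ hθ hθ1
    rw [hg_of θ (Set.mem_Ioi.1 hθ1)]; exact hθ
  have happrox : ∀ P : ℝ → Prop, (∀ᶠ θ in 𝓝[>] (1 : ℝ), P θ) → ∀ ε : ℝ≥0, 0 < ε →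
      ∃ (θ : ℝ) (c : ℝ) (Ψ : TrialState (n + 1) L), P θ ∧ 0 < c ∧ c ^ 2 ≤ 1 + ε ∧
        (Ψ.ψ = fun X => (((c * g θ X : ℝ)) : ℂ)) ∧ energy v Ψ ≤ E₀ + ε := by
    intro P hP ε hε
    obtain ⟨θ, c, Ψ, hθ1, hPθ, hc0, hc2, hψ, hEn⟩ :=
      exists_trialState_energy_le hL hv.1 hK hcont h0 hnn hGS.symm hnorm heig hP hε
    exact ⟨θ, c, Ψ, hPθ, hc0, hc2, by rw [hg_of θ hθ1]; exact hψ, by rw [← hE]; exact hEn⟩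
  exact CutLineWitness.landscape_witness hGS.measurable hC0 hC (fun θ => (hg θ).1)
    (fun θ => (hg θ).2.1) (fun θ => (hg θ).2.2.1) (fun θ => (hg θ).2.2.2) hunif happrox hδ

end LandscapeBoundLine

end Summit.AtomisticToContinuum.BoseEinsteinCondensation.Theorems

end
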